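import Summits.ValiantsHypothesis.ValiantsHypothesis.Theorems.SymmetroidPencilBasics
import Literature.LinearAlgebra.Matrix.PolynomialMinorsDegree
import Literature.AlgebraicGeometry.DeterminantalHypersurfaces.HermitianPencilLinearity

/-!
# Kernel-definite junction, part 5: the bivariate determinant of the junction pencil — degrees and corners

Helper file for the stub `stub_kernelDefiniteJunction` of the line `junction_ceiling` (crux `MatrixDescartes`,
stmt-ValiantsHypothesis-18050).  The junction pencil of `P = ∑ x^{d l} S l` and `Q = ∑ y^{e l} T l` (`T 0 = S last = J`)
is `H_Λ(x) = x^{d 0} · 𝓗(x, x/Λ)` for the FIXED bivariate matrix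
  `𝓗(x, y) = ∑_l x^{d l − d 0} S l + x^{ã} ∑_{l ≥ 1} y^{e l − e 0} T l`,   `ã = d last − d 0`,
typed here as a matrix over `ℝ[y][x]` (outer variable `x`, inner variable `y`) through an ENTRYWISE defining
hypothesis `hH` (no definitions).  With `G = det 𝓗` and `F i j = [x^i y^j] G` this file proves the support and
corner facts the Newton chain (part 4) consumes:
* `natDegree_G_le` (`F i j = 0` for `i > m ã`), `natDegree_coeff_G_le` (`F i j = 0` for `j > m w_K`, `w_K = e last − e 0`);
* `coeff_G_top : G.coeff (m ã) = det Q̃` with `Q̃ = ∑_l y^{e l − e 0} T l` (uses `T 0 = S last`);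
* `F_zero_zero : F 0 0 = det (S 0)`, `coeff_detQ_top : (det Q̃).coeff (m w_K) = det (T last)`,
  `coeff_detQ_zero : (det Q̃).coeff 0 = det (T 0)`.
[folklore] (Leibniz expansion bookkeeping; Literature `natDegree_det_le_of_forall_le`, `coeff_det_of_natDegree_le`.)
-/

-- `Summit.ValiantsHypothesis.ValiantsHypothesis.…` is the tree's mandated single-conjunct layout (Sub = Summit).
set_option linter.dupNamespace false
set_option autoImplicit false

namespace Summit.ValiantsHypothesis.ValiantsHypothesis.Theorems.LacunarySymmetroidMatrixDescartes.JunctionCeiling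

open Polynomial Finset Matrix
open scoped BigOperators

/-! ## 1. Inner degrees (degree in `y` of the `x`-coefficients) under products and determinants -/

/-- inner degree of a product. [folklore] -/
theorem natDegree_coeff_mul_le (p q : Polynomial ℝ[X]) (A B : ℕ)
    (hp : ∀ i, (p.coeff i).natDegree ≤ A) (hq : ∀ i, (q.coeff i).natDegree ≤ B) (i : ℕ) :
    ((p * q).coeff i).natDegree ≤ A + B := by
  rw [coeff_mul]
  exact natDegree_sum_le_of_forall_le _ _ fun x _ => natDegree_mul_le.trans (add_le_add (hp _) (hq _))

/-- inner degree of a finite product. [folklore] -/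
theorem natDegree_coeff_prod_le {ι : Type*} [DecidableEq ι] (s : Finset ι) (f : ι → Polynomial ℝ[X]) (A : ℕ)
    (h : ∀ l ∈ s, ∀ i, ((f l).coeff i).natDegree ≤ A) :
    ∀ i, ((∏ l ∈ s, f l).coeff i).natDegree ≤ s.card * A := by
  induction s using Finset.induction_on with
  | empty =>
    intro i
    simp only [prod_empty, card_empty, zero_mul, nonpos_iff_eq_zero, natDegree_eq_zero_iff_degree_le_zero]
    rw [coeff_one]
    split_ifs <;> simp
  | insert a s ha ih =>
    intro i
    rw [prod_insert ha, card_insert_of_notMem ha, Nat.succ_mul, add_comm (s.card * A)]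
    exact natDegree_coeff_mul_le _ _ A (s.card * A) (h a (mem_insert_self a s))
      (ih fun l hl => h l (mem_insert_of_mem hl)) i

/-- inner degree of a determinant. [folklore] -/
theorem natDegree_coeff_det_le {n : Type*} [Fintype n] [DecidableEq n] (M : Matrix n n (Polynomial ℝ[X]))
    (A : ℕ) (h : ∀ a b i, ((M a b).coeff i).natDegree ≤ A) (i : ℕ) :
    ((det M).coeff i).natDegree ≤ Fintype.card n * A := by
  rw [det_apply, finsetSum_coeff]
  refine natDegree_sum_le_of_forall_le _ _ fun σ _ => ?_
  have hprod : ((∏ k, M (σ k) k).coeff i).natDegree ≤ Fintype.card n * A := by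
    have := natDegree_coeff_prod_le univ (fun k => M (σ k) k) A (fun k _ j => h (σ k) k j) i
    rwa [card_univ] at this
  rcases Int.units_eq_one_or (Equiv.Perm.sign σ) with hσ | hσ
  · rw [hσ, one_smul]; exact hprod
  · rw [hσ, Units.neg_smul, one_smul, coeff_neg, natDegree_neg]; exact hprod

/-! ## 2. The right edge `det Q̃`: entries, degree, top and bottom coefficients -/

section Qtilde

variable {m : ℕ} (K₂ : ℕ) (e : Fin (K₂ + 1) → ℕ) (T : Fin (K₂ + 1) → Matrix (Fin m) (Fin m) ℝ)

/-- entries of `Q̃`. [folklore] -/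
theorem Qtilde_apply (i k : Fin m) :
    (∑ l : Fin (K₂ + 1), (X : ℝ[X]) ^ (e l - e 0) • (T l).map C) i k =
      ∑ l : Fin (K₂ + 1), C (T l i k) * X ^ (e l - e 0) := by
  rw [Matrix.sum_apply]
  refine Finset.sum_congr rfl fun l _ => ?_
  rw [Matrix.smul_apply, Matrix.map_apply, smul_eq_mul, mul_comm]

/-- `deg det Q̃ ≤ m w_K`. [folklore] -/
theorem natDegree_detQ_le (he : Monotone e) :
    (det (∑ l : Fin (K₂ + 1), (X : ℝ[X]) ^ (e l - e 0) • (T l).map C)).natDegree ≤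
      m * (e (Fin.last K₂) - e 0) := by
  have h := Literature.LinearAlgebra.Matrix.natDegree_det_le_of_forall_le
    (∑ l : Fin (K₂ + 1), (X : ℝ[X]) ^ (e l - e 0) • (T l).map C) (D := e (Fin.last K₂) - e 0)
    (fun i k => by
      rw [Qtilde_apply]
      exact natDegree_sum_le_of_forall_le _ _ fun l _ =>
        (natDegree_C_mul_X_pow_le _ _).trans (Nat.sub_le_sub_right (he (Fin.le_last l)) _))
  rwa [Fintype.card_fin] at h

/-- `[y^{m w_K}] det Q̃ = det (T last)`. [folklore] -/
theorem coeff_detQ_top (he : StrictMono e) :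
    (det (∑ l : Fin (K₂ + 1), (X : ℝ[X]) ^ (e l - e 0) • (T l).map C)).coeff (m * (e (Fin.last K₂) - e 0)) =
      det (T (Fin.last K₂)) := by
  have h := Literature.AlgebraicGeometry.DeterminantalHypersurfaces.coeff_det_of_natDegree_le
    (∑ l : Fin (K₂ + 1), (X : ℝ[X]) ^ (e l - e 0) • (T l).map C) (e (Fin.last K₂) - e 0)
    (fun i k => by
      rw [Qtilde_apply]
      exact natDegree_sum_le_of_forall_le _ _ fun l _ =>
        (natDegree_C_mul_X_pow_le _ _).trans (Nat.sub_le_sub_right (he.monotone (Fin.le_last l)) _))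
  rw [Fintype.card_fin] at h
  rw [h]
  congr 1
  ext i k
  rw [Matrix.map_apply, Qtilde_apply, finsetSum_coeff]
  simp only [coeff_C_mul_X_pow]
  rw [Finset.sum_eq_single_of_mem (Fin.last K₂) (mem_univ _)]
  · simp
  · intro l _ hl
    have hlt : e l < e (Fin.last K₂) := he (lt_of_le_of_ne (Fin.le_last l) hl)
    have h0l : e 0 ≤ e l := he.monotone (Fin.zero_le l)
    rw [if_neg (by omega)]

/-- `[y^0] det Q̃ = det (T 0)` (the junction letter). [folklore] -/
theorem coeff_detQ_zero (he : StrictMono e) :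
    (det (∑ l : Fin (K₂ + 1), (X : ℝ[X]) ^ (e l - e 0) • (T l).map C)).coeff 0 = det (T 0) := by
  rw [← constantCoeff_apply, RingHom.map_det, RingHom.mapMatrix_apply]
  congr 1
  ext i k
  rw [Matrix.map_apply, constantCoeff_apply, Qtilde_apply, finsetSum_coeff]
  simp only [coeff_C_mul_X_pow]
  rw [Finset.sum_eq_single_of_mem (0 : Fin (K₂ + 1)) (mem_univ _)]
  · simp
  · intro l _ hl
    have hlt : e 0 < e l := he (lt_of_le_of_ne (Fin.zero_le l) (Ne.symm hl))
    rw [if_neg (by omega)]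

end Qtilde

/-! ## 3. The bivariate matrix: degrees, top `x`-coefficient, corners -/

section Bivariate

variable {m : ℕ} (K₁ K₂ : ℕ) (d : Fin (K₁ + 1) → ℕ) (S : Fin (K₁ + 1) → Matrix (Fin m) (Fin m) ℝ)
  (e : Fin (K₂ + 1) → ℕ) (T : Fin (K₂ + 1) → Matrix (Fin m) (Fin m) ℝ)
  (H : Matrix (Fin m) (Fin m) (Polynomial ℝ[X]))
  (hH : ∀ i k, H i k = (∑ l : Fin (K₁ + 1), C (C (S l i k)) * X ^ (d l - d 0)) +
    ∑ l : Fin K₂, C (C (T l.succ i k) * X ^ (e l.succ - e 0)) * X ^ (d (Fin.last K₁) - d 0))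

include hH

/-- outer (`x`-) degree of the entries: `≤ ã`. [folklore] -/
theorem natDegree_entry_le (hd : Monotone d) (i k : Fin m) : (H i k).natDegree ≤ d (Fin.last K₁) - d 0 := by
  rw [hH]
  refine (natDegree_add_le _ _).trans (max_le ?_ ?_)
  · refine natDegree_sum_le_of_forall_le _ _ fun l _ => (natDegree_C_mul_X_pow_le _ _).trans ?_
    exact Nat.sub_le_sub_right (hd (Fin.le_last l)) _
  · exact natDegree_sum_le_of_forall_le _ _ fun l _ => natDegree_C_mul_X_pow_le _ _

/-- the `x`-coefficients of the entries. [folklore] -/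
theorem coeff_entry (i k : Fin m) (n : ℕ) : (H i k).coeff n =
    (∑ l : Fin (K₁ + 1), if n = d l - d 0 then C (S l i k) else 0) +
      ∑ l : Fin K₂, if n = d (Fin.last K₁) - d 0 then C (T l.succ i k) * X ^ (e l.succ - e 0) else 0 := by
  rw [hH, coeff_add, finsetSum_coeff, finsetSum_coeff]
  simp only [coeff_C_mul_X_pow]

/-- inner (`y`-) degree of the entries: `≤ w_K = e last − e 0`. [folklore] -/
theorem natDegree_coeff_entry_le (he : Monotone e) (i k : Fin m) (n : ℕ) :
    ((H i k).coeff n).natDegree ≤ e (Fin.last K₂) - e 0 := by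
  rw [coeff_entry K₁ K₂ d S e T H hH]
  refine (natDegree_add_le _ _).trans (max_le ?_ ?_)
  · refine natDegree_sum_le_of_forall_le _ _ fun l _ => ?_
    split_ifs
    · exact (natDegree_C _).le.trans (Nat.zero_le _)
    · simp
  · refine natDegree_sum_le_of_forall_le _ _ fun l _ => ?_
    split_ifs
    · exact (natDegree_C_mul_X_pow_le _ _).trans (Nat.sub_le_sub_right (he (Fin.le_last _)) _)
    · simp

/-- **support in `x`**: `deg_x G ≤ m ã`. [folklore] -/
theorem natDegree_G_le (hd : Monotone d) : (det H).natDegree ≤ m * (d (Fin.last K₁) - d 0) := by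
  have h := Literature.LinearAlgebra.Matrix.natDegree_det_le_of_forall_le H
    (D := d (Fin.last K₁) - d 0) (fun i k => natDegree_entry_le K₁ K₂ d S e T H hH hd i k)
  rwa [Fintype.card_fin] at h

/-- **support in `y`**: every `x`-coefficient of `G` has `y`-degree `≤ m w_K`. [folklore] -/
theorem natDegree_coeff_G_le (he : Monotone e) (i : ℕ) :
    ((det H).coeff i).natDegree ≤ m * (e (Fin.last K₂) - e 0) := by
  have h := natDegree_coeff_det_le H (e (Fin.last K₂) - e 0)
    (fun a b n => natDegree_coeff_entry_le K₁ K₂ d S e T H hH he a b n) i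
  rwa [Fintype.card_fin] at h

/-- **top `x`-coefficient**: `[x^{m ã}] G = det Q̃`, `Q̃ = ∑_l y^{e l − e 0} T l` (using `T 0 = S last`). [folklore] -/
theorem coeff_G_top (hd : StrictMono d) (h0 : T 0 = S (Fin.last K₁)) :
    (det H).coeff (m * (d (Fin.last K₁) - d 0)) =
      det (∑ l : Fin (K₂ + 1), (X : ℝ[X]) ^ (e l - e 0) • (T l).map C) := by
  have h := Literature.AlgebraicGeometry.DeterminantalHypersurfaces.coeff_det_of_natDegree_le H
    (d (Fin.last K₁) - d 0) (fun i k => natDegree_entry_le K₁ K₂ d S e T H hH hd.monotone i k)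
  rw [Fintype.card_fin] at h
  rw [h]
  congr 1
  apply Matrix.ext
  intro i k
  rw [Matrix.map_apply, coeff_entry K₁ K₂ d S e T H hH, Qtilde_apply K₂ e T i k]
  conv_rhs => rw [Fin.sum_univ_succ]
  have h1 : (∑ l : Fin (K₁ + 1), if d (Fin.last K₁) - d 0 = d l - d 0 then C (S l i k) else (0 : ℝ[X])) =
      C (S (Fin.last K₁) i k) := by
    rw [Finset.sum_eq_single_of_mem (Fin.last K₁) (mem_univ _)]
    · rw [if_pos rfl]
    · intro l _ hl
      have hlt : d l < d (Fin.last K₁) := hd (lt_of_le_of_ne (Fin.le_last l) hl)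
      have h0l : d 0 ≤ d l := hd.monotone (Fin.zero_le l)
      rw [if_neg (by omega)]
  rw [h1, ← h0]
  congr 1
  · rw [Nat.sub_self, pow_zero, mul_one]
  · refine Finset.sum_congr rfl fun l _ => ?_
    rw [if_pos rfl]

/-- **bottom-left corner**: `F 0 0 = det (S 0)` (`d` strictly increasing, the appended exponents `e l − e 0 ≥ 1`).
[folklore] -/
theorem F_zero_zero (hd : StrictMono d) (he : StrictMono e) :
    ((det H).coeff 0).coeff 0 = det (S 0) := by
  have h1 : (det H).coeff 0 = det (H.map constantCoeff) := by
    rw [← constantCoeff_apply, RingHom.map_det, RingHom.mapMatrix_apply]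
  have h2 : (det (H.map constantCoeff)).coeff 0 = det ((H.map constantCoeff).map constantCoeff) := by
    rw [← constantCoeff_apply, RingHom.map_det, RingHom.mapMatrix_apply]
  rw [h1, h2]
  congr 1
  ext i k
  rw [Matrix.map_apply, Matrix.map_apply, constantCoeff_apply, constantCoeff_apply,
    coeff_entry K₁ K₂ d S e T H hH, coeff_add, finsetSum_coeff, finsetSum_coeff]
  have hA : (∑ l : Fin (K₁ + 1), (if 0 = d l - d 0 then C (S l i k) else (0 : ℝ[X])).coeff 0) = S 0 i k := by
    rw [Finset.sum_eq_single_of_mem (0 : Fin (K₁ + 1)) (mem_univ _)]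
    · rw [Nat.sub_self, if_pos rfl, coeff_C_zero]
    · intro l _ hl
      have hlt : d 0 < d l := hd (lt_of_le_of_ne (Fin.zero_le l) (Ne.symm hl))
      rw [if_neg (by omega), coeff_zero]
  have hB : (∑ l : Fin K₂, (if 0 = d (Fin.last K₁) - d 0 then C (T l.succ i k) * X ^ (e l.succ - e 0)
      else (0 : ℝ[X])).coeff 0) = 0 := by
    refine Finset.sum_eq_zero fun l _ => ?_
    split_ifs
    · rw [coeff_C_mul_X_pow, if_neg]
      have : e 0 < e l.succ := he (Fin.succ_pos l)
      omega
    · exact coeff_zero 0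
  rw [hA, hB, add_zero]

end Bivariate


end Summit.ValiantsHypothesis.ValiantsHypothesis.Theorems.LacunarySymmetroidMatrixDescartes.JunctionCeiling
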